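import Summits.HodgeConjecture.HodgeConjecture.Theorems.TropicalWeilObstructionTropicalWeilVanishingDegreeLadderPotentials
import HarnessLib

/-!
# Route `TropicalWeilObstruction` (Kontsevich's tropical test — NEGATION SINK, exploration, no summit claim):
# the degree ladder of K1 — V. the closed chain of floored reference facets (★) and the second descent `12 ∣ intCoord Z`

Negation-sink bookkeeping of the cell `pub-hodge-tropical` (seat tropical-1 gen 7); part V of the DEGREE LADDER. Part I (p343636)
proved `intCoord Z (I,S') = 4·X`, `X = Σ_{σ,i} ±n_σ k_{σ,i,I₀} det₃(ρ̄_{f(σ,i)}|_I)` a `k`-weighted sum of `3`-volumes of the floored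
reference facets `ρ̄_f = ⌊Q⁻¹ r_f⌋`. Here:

* `closedness_transfer` (★) — for every ALTERNATING, TRANSLATION-INVARIANT function `H` of `3`-tuples of points and every
  coordinate `a`: `Σ_{σ,i} ±n_σ k_{σ,i,a} Σ_l (−1)^l H(ρ̄_{f(σ,i)}∘δ_l) = 0` — the `k`-weighted `3`-chain of floored reference facets is
  CLOSED. Proof: pair `∂∂ = 0` on the floored cells (part III) with `Ĥ(z) = (Σ_m z_{m,a})·H(z)` (alternating,
  `Ĥ(z+t) = Ĥ(z) + 3t_aH(z)`), rewrite each facet as a reordered translate of its reference (`facet_eq`, part III's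
  `boundaryPairing_perm`), and kill the `Ĥ(reference)` terms class by class (`balanced`);
* `exists_level_two_weight` — `E₃(·|_I) = Hc + 3L` with `Hc` alternating translation-invariant (canonicalisation, part IV) and the
  WEIGHT `L(z) = −t_z(I₁)·det₂(z|_I)`: alternating, zero on degenerate tuples, `L(z+s) = L(z) + s_{I₁}det₂(z|_I)`;
* `exists_weight_intCoord_eq_twelve_mul` — hence `intCoord Z (I,S') = 12 · Σ_{σ,i} ±n_σ k_{σ,i,I₀} Σ_l (−1)^l L(ρ̄_{f(σ,i)}∘δ_l)` for EVERY
  period (`det Q ≠ 0`) and every effective tropical `4`-cycle; `twelve_dvd_intCoord`.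

HONEST STATUS. Elementary algebra/combinatorics on the certificate format; decides nothing about K1 (`TropicalWeilVanishing`,
stmt-HodgeConjecture-18478, an OPEN problem) or about the Hodge conjecture. No definition (display-only notation), no named fact,
no sorry.
References: [MikhalkinZharkov2014Eigenwave] G. Mikhalkin, I. Zharkov, Tropical eigenwave and intermediate Jacobians,
LN UMI 15 (2014), Def. 4.2, Prop. 4.3, Thm. 5.4; [Zharkov2020TropicalWeil] I. Zharkov, arXiv:2002.02347, p. 2, §2.
-/

set_option linter.dupNamespace false

noncomputable section

open scoped BigOperators
open Matrix
open Literature.AlgebraicGeometry.Tropical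
open Summit.HodgeConjecture.HodgeConjecture.Theorems.TropicalHodgeBound

namespace Summit.HodgeConjecture.HodgeConjecture.Theorems.TropicalWeilVanishing.Ladder

/-! ## §0 Display-only notation (nothing is defined) -/

/-- The facet `3`-volume `det [(y_{j+1} - y_0)_{a+1}]_{j,a<3}` of four points with four coordinates. Nothing is defined. -/
local notation3 (prettyPrint := false) "𝐕⟦" y "⟧" =>
  (Matrix.det (Matrix.of fun (j : Fin 3) (a : Fin 3) => y (Fin.succ j) (Fin.succ a) - y 0 (Fin.succ a)))

/-- The `2`-volume `det [(z_{j+1} - z_0)_{a+2}]_{j,a<2}` of three points with four coordinates. Nothing is defined. -/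
local notation3 (prettyPrint := false) "𝐕₂⟦" z "⟧" =>
  (Matrix.det (Matrix.of fun (j : Fin 2) (a : Fin 2) => z (Fin.succ j) (Fin.succ (Fin.succ a)) - z 0 (Fin.succ (Fin.succ a))))

/-- The level-`3` potential `E₃(z) = (Σ_m z_{m,1}) · det [(z_{j+1} - z_0)_{a+2}]` (`6 ∫_{[z]} x₁ dx₂ ∧ dx₃`). Nothing is defined. -/
local notation3 (prettyPrint := false) "𝐄₃⟦" z "⟧" =>
  ((∑ m : Fin 3, z m (1 : Fin 4)) *
    Matrix.det (Matrix.of fun (j : Fin 2) (a : Fin 2) => z (Fin.succ j) (Fin.succ (Fin.succ a)) - z 0 (Fin.succ (Fin.succ a))))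

/-! ## §1 (★) The `k`-weighted chain of floored reference facets is closed -/

section Closed

variable {g : ℕ} {Q : Matrix (Fin g) (Fin g) ℝ}

/-- **(★) Closedness transfer.** For every function `H` of `3`-tuples of points of `ℤᵍ` which is ALTERNATING and
TRANSLATION-INVARIANT, every coordinate `a` and every word `S'`:
`Σ_{σ,i} w_σ Δ_{S'}(L_σ) (−1)^i sign(π_{σ,i}) k_{σ,i,a} · Σ_l (−1)^l H(ρ̄_{f(σ,i)} ∘ δ_l) = 0` (`ρ̄_f = ⌊Q⁻¹ r_f⌋`). The proof pairs
`∂∂ = 0` on the floored cells with `Ĥ(z) = (Σ_m z_{m,a}) H(z)`. [cite: MikhalkinZharkov2014Eigenwave, Prop. 4.3] -/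
theorem closedness_transfer (hQ : IsUnit Q.det) (Z : TropicalTorusCycle g 4 Q) (S' : Fin 4 → Fin g) (a : Fin g)
    (H : (Fin 3 → Fin g → ℤ) → ℤ)
    (hHalt : ∀ (z : Fin 3 → Fin g → ℤ) (κ : Equiv.Perm (Fin 3)),
      H (fun j => z (κ j)) = ((Equiv.Perm.sign κ : ℤˣ) : ℤ) * H z)
    (hHtr : ∀ (z : Fin 3 → Fin g → ℤ) (t : Fin g → ℤ), H (fun j r => z j r + t r) = H z) :
    ∑ σ, ∑ i : Fin 5, ((Z.cell σ).weight : ℤ) * pluckerCoord (Z.cell σ).frame S' * (-1) ^ (i : ℕ) *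
      ((Equiv.Perm.sign (Z.facetPerm σ i) : ℤˣ) : ℤ) * Z.facetShift σ i a *
      ∑ l : Fin 4, (-1) ^ (l : ℕ) *
        H (fun j => fun r => ⌊(Q⁻¹ *ᵥ Z.refFacet (Z.facetClass σ i) (l.succAbove j)) r⌋) = 0 := by
  classical
  -- floored period coordinates; facets are integer translates of the floored reference facets (as in part I)
  set u : Fin Z.numCells → Fin 5 → Fin g → ℤ := fun σ k r => ⌊(Q⁻¹ *ᵥ (Z.cell σ).vertex k) r⌋ with hu
  set ρ : Fin Z.numFacetClasses → Fin 4 → Fin g → ℤ := fun f j r => ⌊(Q⁻¹ *ᵥ Z.refFacet f j) r⌋ with hρ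
  have hfacet : ∀ σ i j r, u σ (i.succAbove (Z.facetPerm σ i j)) r =
      ρ (Z.facetClass σ i) j r + Z.facetShift σ i r := by
    intro σ i j r
    have hv : (Z.cell σ).vertex (i.succAbove (Z.facetPerm σ i j)) =
        Z.refFacet (Z.facetClass σ i) j + Q *ᵥ fun b => (Z.facetShift σ i b : ℝ) := by
      funext a'; rw [Z.facet_eq σ i j a']; rfl
    simp only [hu, hρ, hv, Matrix.mulVec_add, Matrix.mulVec_mulVec, Matrix.nonsing_inv_mul Q hQ,
      Matrix.one_mulVec, Pi.add_apply, Int.floor_add_intCast]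
  set n : Fin Z.numCells → ℤ := fun σ => ((Z.cell σ).weight : ℤ) * pluckerCoord (Z.cell σ).frame S' with hn
  -- the test function `Ĝ(z) = (Σ_m z_{m,a}) H(z)`: alternating, `Ĝ(z + t) = Ĝ(z) + 3 t_a H(z)`
  set G : (Fin 3 → Fin g → ℤ) → ℤ := fun z => (∑ m : Fin 3, z m a) * H z with hG
  have hGalt : ∀ (z : Fin 3 → Fin g → ℤ) (κ : Equiv.Perm (Fin 3)),
      G (fun j => z (κ j)) = ((Equiv.Perm.sign κ : ℤˣ) : ℤ) • G z := by
    intro z κ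
    simp only [hG, smul_eq_mul]
    rw [hHalt z κ, Equiv.sum_comp κ (fun m => z m a)]
    ring
  have hGtr : ∀ (z : Fin 3 → Fin g → ℤ) (t : Fin g → ℤ),
      G (fun j r => z j r + t r) = G z + 3 * t a * H z := by
    intro z t
    simp only [hG]
    rw [hHtr z t, Finset.sum_add_distrib, Finset.sum_const, Finset.card_univ, Fintype.card_fin, nsmul_eq_mul]
    push_cast
    ring
  -- the boundary pairing of `G` on the facet slot `(σ, i)`
  have hslot : ∀ σ i, ∑ l : Fin 4, ((-1 : ℤ) ^ (l : ℕ)) • G (fun j => u σ (i.succAbove (l.succAbove j))) =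
      ((Equiv.Perm.sign (Z.facetPerm σ i) : ℤˣ) : ℤ) *
        ((∑ l : Fin 4, ((-1 : ℤ) ^ (l : ℕ)) • G (fun j => ρ (Z.facetClass σ i) (l.succAbove j))) +
          3 * Z.facetShift σ i a *
            ∑ l : Fin 4, ((-1 : ℤ) ^ (l : ℕ)) • H (fun j => ρ (Z.facetClass σ i) (l.succAbove j))) := by
    intro σ i
    -- the facet as a reordered translate: `u σ (i.succAbove m) = y (π⁻¹ m)` with `y = ρ_f + k`
    set y : Fin 4 → Fin g → ℤ := fun j r => ρ (Z.facetClass σ i) j r + Z.facetShift σ i r with hy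
    have hface : ∀ l : Fin 4, (fun j => u σ (i.succAbove (l.succAbove j))) =
        fun j => y ((Z.facetPerm σ i)⁻¹ (l.succAbove j)) := by
      intro l; funext j; funext r
      have h := hfacet σ i ((Z.facetPerm σ i).symm (l.succAbove j)) r
      rw [Equiv.apply_symm_apply] at h
      rw [Equiv.Perm.coe_inv, hy, h]
    simp_rw [hface]
    rw [boundaryPairing_perm G hGalt (Z.facetPerm σ i)⁻¹ y, Equiv.Perm.sign_inv, smul_eq_mul]
    congr 1
    have hyl : ∀ l : Fin 4, G (fun j => y (l.succAbove j)) =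
        G (fun j => ρ (Z.facetClass σ i) (l.succAbove j)) +
          3 * Z.facetShift σ i a * H (fun j => ρ (Z.facetClass σ i) (l.succAbove j)) :=
      fun l => hGtr (fun j => ρ (Z.facetClass σ i) (l.succAbove j)) (Z.facetShift σ i)
    simp_rw [hyl]
    rw [Finset.mul_sum, ← Finset.sum_add_distrib]
    exact Finset.sum_congr rfl fun l _ => by rw [smul_eq_mul, smul_eq_mul, smul_eq_mul]; ring
  -- `∂∂ = 0` on every cell, summed with the coefficients `n σ`
  have hdd : ∑ σ, ∑ i : Fin 5, n σ * (-1) ^ (i : ℕ) *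
      ∑ l : Fin 4, ((-1 : ℤ) ^ (l : ℕ)) • G (fun j => u σ (i.succAbove (l.succAbove j))) = 0 := by
    refine Finset.sum_eq_zero fun σ _ => ?_
    have h := sum_sum_sign_faceFace G (u σ)
    have e : ∀ i : Fin 5, n σ * (-1 : ℤ) ^ (i : ℕ) *
        ∑ l : Fin 4, ((-1 : ℤ) ^ (l : ℕ)) • G (fun j => u σ (i.succAbove (l.succAbove j))) =
        n σ * ∑ l : Fin 4, ((-1 : ℤ) ^ ((i : ℕ) + (l : ℕ))) • G (fun j => u σ (i.succAbove (l.succAbove j))) := by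
      intro i
      rw [mul_assoc, Finset.mul_sum, Finset.mul_sum, Finset.mul_sum]
      refine Finset.sum_congr rfl fun l _ => ?_
      rw [smul_eq_mul, smul_eq_mul, pow_add]; ring
    simp_rw [e]
    rw [← Finset.mul_sum, h, mul_zero]
  -- substitute `hslot` into `hdd`
  have hdd' : ∑ σ, ∑ i : Fin 5, n σ * (-1) ^ (i : ℕ) * ((Equiv.Perm.sign (Z.facetPerm σ i) : ℤˣ) : ℤ) *
      (∑ l : Fin 4, ((-1 : ℤ) ^ (l : ℕ)) • G (fun j => ρ (Z.facetClass σ i) (l.succAbove j))) +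
      3 * ∑ σ, ∑ i : Fin 5, n σ * (-1) ^ (i : ℕ) * ((Equiv.Perm.sign (Z.facetPerm σ i) : ℤˣ) : ℤ) *
        Z.facetShift σ i a *
        ∑ l : Fin 4, ((-1 : ℤ) ^ (l : ℕ)) • H (fun j => ρ (Z.facetClass σ i) (l.succAbove j)) = 0 := by
    rw [← hdd, Finset.mul_sum, ← Finset.sum_add_distrib]
    refine Finset.sum_congr rfl fun σ _ => ?_
    rw [Finset.mul_sum, ← Finset.sum_add_distrib]
    refine Finset.sum_congr rfl fun i _ => ?_
    rw [hslot σ i]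
    ring
  -- the `Ĝ(reference)` terms cancel class by class (`balanced`)
  have hbal : ∑ σ, ∑ i : Fin 5, n σ * (-1) ^ (i : ℕ) * ((Equiv.Perm.sign (Z.facetPerm σ i) : ℤˣ) : ℤ) *
      (∑ l : Fin 4, ((-1 : ℤ) ^ (l : ℕ)) • G (fun j => ρ (Z.facetClass σ i) (l.succAbove j))) = 0 := by
    have hreg : ∀ σ (i : Fin 5), n σ * (-1) ^ (i : ℕ) * ((Equiv.Perm.sign (Z.facetPerm σ i) : ℤˣ) : ℤ) *
        (∑ l : Fin 4, ((-1 : ℤ) ^ (l : ℕ)) • G (fun j => ρ (Z.facetClass σ i) (l.succAbove j))) =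
        ∑ f, (∑ l : Fin 4, ((-1 : ℤ) ^ (l : ℕ)) • G (fun j => ρ f (l.succAbove j))) *
          (if Z.facetClass σ i = f then
            ((Z.cell σ).weight : ℤ) * (-1) ^ (i : ℕ) * ((Equiv.Perm.sign (Z.facetPerm σ i) : ℤˣ) : ℤ) *
              pluckerCoord (Z.cell σ).frame S' else 0) := by
      intro σ i
      rw [Finset.sum_eq_single (Z.facetClass σ i)]
      · rw [if_pos rfl, hn]; ring
      · intro f _ hf; rw [if_neg (Ne.symm hf), mul_zero]
      · intro h; exact absurd (Finset.mem_univ _) h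
    simp_rw [hreg]
    calc ∑ σ, ∑ i : Fin 5, ∑ f, (∑ l : Fin 4, ((-1 : ℤ) ^ (l : ℕ)) • G (fun j => ρ f (l.succAbove j))) *
          (if Z.facetClass σ i = f then
            ((Z.cell σ).weight : ℤ) * (-1) ^ (i : ℕ) * ((Equiv.Perm.sign (Z.facetPerm σ i) : ℤˣ) : ℤ) *
              pluckerCoord (Z.cell σ).frame S' else 0)
        = ∑ σ, ∑ f, ∑ i : Fin 5, (∑ l : Fin 4, ((-1 : ℤ) ^ (l : ℕ)) • G (fun j => ρ f (l.succAbove j))) *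
          (if Z.facetClass σ i = f then
            ((Z.cell σ).weight : ℤ) * (-1) ^ (i : ℕ) * ((Equiv.Perm.sign (Z.facetPerm σ i) : ℤˣ) : ℤ) *
              pluckerCoord (Z.cell σ).frame S' else 0) := Finset.sum_congr rfl fun σ _ => Finset.sum_comm
      _ = ∑ f, ∑ σ, ∑ i : Fin 5, (∑ l : Fin 4, ((-1 : ℤ) ^ (l : ℕ)) • G (fun j => ρ f (l.succAbove j))) *
          (if Z.facetClass σ i = f then
            ((Z.cell σ).weight : ℤ) * (-1) ^ (i : ℕ) * ((Equiv.Perm.sign (Z.facetPerm σ i) : ℤˣ) : ℤ) *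
              pluckerCoord (Z.cell σ).frame S' else 0) := Finset.sum_comm
      _ = ∑ f, (∑ l : Fin 4, ((-1 : ℤ) ^ (l : ℕ)) • G (fun j => ρ f (l.succAbove j))) *
          ∑ σ, ∑ i : Fin 5, (if Z.facetClass σ i = f then
            ((Z.cell σ).weight : ℤ) * (-1) ^ (i : ℕ) * ((Equiv.Perm.sign (Z.facetPerm σ i) : ℤˣ) : ℤ) *
              pluckerCoord (Z.cell σ).frame S' else 0) := by
          refine Finset.sum_congr rfl fun f _ => ?_
          rw [Finset.mul_sum]
          exact Finset.sum_congr rfl fun σ _ => by rw [Finset.mul_sum]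
      _ = 0 := Finset.sum_eq_zero fun f _ => by rw [Z.balanced f S', mul_zero]
  -- conclude: `3 · (goal) = 0`
  rw [hbal, zero_add] at hdd'
  have h3 : (3 : ℤ) ≠ 0 := by norm_num
  have hT := (mul_eq_zero.mp hdd').resolve_left h3
  simpa only [hn, hρ, smul_eq_mul] using hT

end Closed


/-! ## §2 The second descent: `intCoord Z = 12 · Y` -/

section Twelve

variable {g : ℕ} {Q : Matrix (Fin g) (Fin g) ℝ}

/-- **The level-`2` weight.** For every choice of coordinates `I` there is an integer function `L` of `3`-tuples of points
— `L(z) = −t_z(I₁) · det₂[(z_{j+1}−z_0)_{I₂I₃}]` for the canonical presentation `rep z = z∘κ_z + t_z` — which is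
ALTERNATING, vanishes on degenerate tuples, obeys the translation law `L(z + s) = L(z) + s_{I₁} det₂[…]`, and such that
`E₃(z|_I) − 3 L(z)` is alternating and TRANSLATION-INVARIANT. [folklore] -/
theorem exists_level_two_weight (I : Fin 4 → Fin g) :
    ∃ (Hc L : (Fin 3 → Fin g → ℤ) → ℤ),
      (∀ (z : Fin 3 → Fin g → ℤ) (κ : Equiv.Perm (Fin 3)),
        Hc (fun j => z (κ j)) = ((Equiv.Perm.sign κ : ℤˣ) : ℤ) * Hc z) ∧
      (∀ (z : Fin 3 → Fin g → ℤ) (t : Fin g → ℤ), Hc (fun j r => z j r + t r) = Hc z) ∧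
      (∀ z : Fin 3 → Fin g → ℤ, 𝐄₃⟦fun j b => z j (I b)⟧ = Hc z + 3 * L z) ∧
      (∀ (z : Fin 3 → Fin g → ℤ) (κ : Equiv.Perm (Fin 3)),
        L (fun j => z (κ j)) = ((Equiv.Perm.sign κ : ℤˣ) : ℤ) * L z) ∧
      (∀ (z : Fin 3 → Fin g → ℤ) (s : Fin g → ℤ),
        L (fun j r => z j r + s r) = L z + s (I 1) * 𝐕₂⟦fun j b => z j (I b)⟧) ∧
      (∀ z : Fin 3 → Fin g → ℤ, ¬ Function.Injective z → L z = 0) := by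
  classical
  obtain ⟨rep, κf, tf, hκt, hθ, hs, hκθ, hκs, hdeg⟩ := exists_canonical_presentation 3 g
  -- `E₃(·|_I)` is alternating and vanishes on degenerate tuples
  have hV2deg : ∀ z : Fin 3 → Fin g → ℤ, ¬ Function.Injective z → 𝐕₂⟦fun j b => z j (I b)⟧ = 0 := by
    intro z hz
    refine vol2_eq_zero_of_not_injective (fun j b => z j (I b)) fun hinj => hz fun p q hpq => hinj ?_
    beta_reduce; rw [hpq]
  have hE3deg : ∀ z : Fin 3 → Fin g → ℤ, ¬ Function.Injective z → 𝐄₃⟦fun j b => z j (I b)⟧ = 0 := by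
    intro z hz
    have h := hV2deg z hz
    beta_reduce at h ⊢
    rw [h, mul_zero]
  obtain ⟨halt, htr⟩ := canonicalise rep κf tf hθ hs hκθ hκs hdeg (fun z => 𝐄₃⟦fun j b => z j (I b)⟧)
    (fun z hz => hE3deg z hz)
  -- the relation `sign(κ_z) E₃(rep z|_I) = E₃(z|_I) + 3 t_z(I₁) V₂(z|_I)`
  have hrel : ∀ z : Fin 3 → Fin g → ℤ,
      ((Equiv.Perm.sign (κf z) : ℤˣ) : ℤ) * 𝐄₃⟦fun j b => rep z j (I b)⟧ =
        𝐄₃⟦fun j b => z j (I b)⟧ + 3 * tf z (I 1) * 𝐕₂⟦fun j b => z j (I b)⟧ := by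
    intro z
    have hpres := hκt z
    have hadd := potential3_add_const (fun j b => z (κf z j) (I b)) (fun b => tf z (I b))
    have hperm := potential3_comp_perm (fun j b => z j (I b)) (κf z)
    have hV := det_sub_perm (fun (k : Fin 3) (b : Fin 2) => z k (I b.succ.succ)) (κf z)
    have hs2 : ((Equiv.Perm.sign (κf z) : ℤˣ) : ℤ) * ((Equiv.Perm.sign (κf z) : ℤˣ) : ℤ) = 1 := by
      rw [← Units.val_mul, Int.units_mul_self, Units.val_one]
    have hV' : Matrix.det (Matrix.of fun (j : Fin 2) (b : Fin 2) =>
        z (κf z j.succ) (I b.succ.succ) - z (κf z 0) (I b.succ.succ)) =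
        ((Equiv.Perm.sign (κf z) : ℤˣ) : ℤ) *
          Matrix.det (Matrix.of fun (j : Fin 2) (b : Fin 2) => z j.succ (I b.succ.succ) - z 0 (I b.succ.succ)) := by
      have e2 : (Matrix.of fun (j : Fin 2) (b : Fin 2) => z (κf z j.succ) (I b.succ.succ) - z (κf z 0) (I b.succ.succ)) =
          Matrix.of fun j : Fin 2 => (fun (k : Fin 3) (b : Fin 2) => z k (I b.succ.succ)) (κf z j.succ) -
            (fun (k : Fin 3) (b : Fin 2) => z k (I b.succ.succ)) (κf z 0) := by ext j b; rfl
      have e3 : (Matrix.of fun (j : Fin 2) (b : Fin 2) => z j.succ (I b.succ.succ) - z 0 (I b.succ.succ)) =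
          Matrix.of fun j : Fin 2 => (fun (k : Fin 3) (b : Fin 2) => z k (I b.succ.succ)) j.succ -
            (fun (k : Fin 3) (b : Fin 2) => z k (I b.succ.succ)) 0 := by ext j b; rfl
      rw [e2, hV, ← e3, Int.cast_id]
    beta_reduce at hadd hperm ⊢
    simp_rw [hpres]
    rw [hadd, hperm, hV']
    linear_combination (𝐄₃⟦fun j b => z j (I b)⟧ + 3 * tf z (I 1) * 𝐕₂⟦fun j b => z j (I b)⟧) * hs2
  refine ⟨fun z => ((Equiv.Perm.sign (κf z) : ℤˣ) : ℤ) * 𝐄₃⟦fun j b => rep z j (I b)⟧,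
    fun z => -(tf z (I 1) * 𝐕₂⟦fun j b => z j (I b)⟧), halt, htr, ?_, ?_, ?_, ?_⟩
  · intro z; beta_reduce; rw [hrel z]; ring
  · -- `L` alternating
    intro z θ
    beta_reduce
    have hVθ : 𝐕₂⟦fun j b => z (θ j) (I b)⟧ = ((Equiv.Perm.sign θ : ℤˣ) : ℤ) * 𝐕₂⟦fun j b => z j (I b)⟧ := by
      have hV := det_sub_perm (fun (k : Fin 3) (b : Fin 2) => z k (I b.succ.succ)) θ
      have e2 : (Matrix.of fun (j : Fin 2) (b : Fin 2) => z (θ j.succ) (I b.succ.succ) - z (θ 0) (I b.succ.succ)) =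
          Matrix.of fun j : Fin 2 => (fun (k : Fin 3) (b : Fin 2) => z k (I b.succ.succ)) (θ j.succ) -
            (fun (k : Fin 3) (b : Fin 2) => z k (I b.succ.succ)) (θ 0) := by ext j b; rfl
      have e3 : (Matrix.of fun (j : Fin 2) (b : Fin 2) => z j.succ (I b.succ.succ) - z 0 (I b.succ.succ)) =
          Matrix.of fun j : Fin 2 => (fun (k : Fin 3) (b : Fin 2) => z k (I b.succ.succ)) j.succ -
            (fun (k : Fin 3) (b : Fin 2) => z k (I b.succ.succ)) 0 := by ext j b; rfl
      beta_reduce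
      rw [e2, hV, ← e3, Int.cast_id]
    by_cases hz : Function.Injective z
    · obtain ⟨-, ht⟩ := hκθ z θ hz
      rw [ht, hVθ]; ring
    · have h0 := hV2deg z hz
      have hzθ : ¬ Function.Injective (fun j => z (θ j)) := fun h => hz (by
        intro p q hpq
        have := @h (θ.symm p) (θ.symm q) (by simpa using hpq)
        simpa using this)
      have h1 := hV2deg _ hzθ
      beta_reduce at h0 h1
      rw [h0, h1, mul_zero, mul_zero, neg_zero, mul_zero]
  · -- translation law
    intro z s
    beta_reduce
    have hVs : 𝐕₂⟦fun j b => z j (I b) + s (I b)⟧ = 𝐕₂⟦fun j b => z j (I b)⟧ := by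
      congr 1; ext j b; simp only [Matrix.of_apply, add_sub_add_right_eq_sub]
    by_cases hz : Function.Injective z
    · obtain ⟨-, ht⟩ := hκs z s hz
      rw [ht]
      beta_reduce
      rw [hVs]; ring
    · have h0 := hV2deg z hz
      have hzs : ¬ Function.Injective (fun j r => z j r + s r) := fun h => hz (by
        intro p q hpq
        exact h (by funext r; simp only [hpq]))
      have h1 := hV2deg _ hzs
      beta_reduce at h0 h1
      rw [h0, h1, mul_zero, mul_zero, neg_zero, zero_add, mul_zero]
  · -- degenerate tuples
    intro z hz
    have h0 := hV2deg z hz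
    beta_reduce at h0 ⊢
    rw [h0, mul_zero, neg_zero]

/-- **The second descent, with the weight exposed**: for every `I` there is a level-`2` weight `L` (alternating, vanishing
on degenerate tuples, translation law `L(z+s) = L(z) + s_{I₁}det₂`) such that for EVERY period matrix `Q` (`det Q ≠ 0`),
every effective tropical `4`-cycle `Z` on `ℝᵍ/Qℤᵍ` and every word `S'`:
`intCoord Z (I,S') = 12 · Σ_{σ,i} w_σ Δ_{S'}(L_σ) (−1)^i sign(π_{σ,i}) k_{σ,i,I₀} Σ_l (−1)^l L(ρ̄_{f(σ,i)} ∘ δ_l)`.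
[cite: MikhalkinZharkov2014Eigenwave, Prop. 4.3] -/
theorem exists_weight_intCoord_eq_twelve_mul (g : ℕ) (I : Fin 4 → Fin g) :
    ∃ L : (Fin 3 → Fin g → ℤ) → ℤ,
      (∀ (z : Fin 3 → Fin g → ℤ) (κ : Equiv.Perm (Fin 3)),
        L (fun j => z (κ j)) = ((Equiv.Perm.sign κ : ℤˣ) : ℤ) * L z) ∧
      (∀ (z : Fin 3 → Fin g → ℤ) (s : Fin g → ℤ),
        L (fun j r => z j r + s r) = L z + s (I 1) * 𝐕₂⟦fun j b => z j (I b)⟧) ∧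
      (∀ z : Fin 3 → Fin g → ℤ, ¬ Function.Injective z → L z = 0) ∧
      ∀ (Q : Matrix (Fin g) (Fin g) ℝ) (_hQ : IsUnit Q.det) (Z : TropicalTorusCycle g 4 Q) (S' : Fin 4 → Fin g),
        intCoord Z I S' = 12 * ∑ σ, ∑ i : Fin 5,
          ((Z.cell σ).weight : ℤ) * pluckerCoord (Z.cell σ).frame S' * (-1) ^ (i : ℕ) *
            ((Equiv.Perm.sign (Z.facetPerm σ i) : ℤˣ) : ℤ) * Z.facetShift σ i (I 0) *
            ∑ l : Fin 4, (-1) ^ (l : ℕ) *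
              L (fun j => fun r => ⌊(Q⁻¹ *ᵥ Z.refFacet (Z.facetClass σ i) (l.succAbove j)) r⌋) := by
  classical
  obtain ⟨Hc, L, hHalt, hHtr, hE, hLalt, hLtr, hLdeg⟩ := exists_level_two_weight (g := g) I
  refine ⟨L, hLalt, hLtr, hLdeg, fun Q hQ Z S' => ?_⟩
  have hstar := closedness_transfer hQ Z S' (I 0) Hc hHalt hHtr
  rw [intCoord_eq_four_mul hQ Z I S']
  have hX : ∑ σ, ∑ i : Fin 5,
      ((Z.cell σ).weight : ℤ) * pluckerCoord (Z.cell σ).frame S' * (-1) ^ (i : ℕ) *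
        ((Equiv.Perm.sign (Z.facetPerm σ i) : ℤˣ) : ℤ) *
        (Z.facetShift σ i (I 0) *
          𝐕⟦fun (k : Fin 4) (b : Fin 4) => ⌊(Q⁻¹ *ᵥ Z.refFacet (Z.facetClass σ i) k) (I b)⌋⟧) =
      0 + 3 * ∑ σ, ∑ i : Fin 5,
          ((Z.cell σ).weight : ℤ) * pluckerCoord (Z.cell σ).frame S' * (-1) ^ (i : ℕ) *
            ((Equiv.Perm.sign (Z.facetPerm σ i) : ℤˣ) : ℤ) * Z.facetShift σ i (I 0) *
            ∑ l : Fin 4, (-1) ^ (l : ℕ) *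
              L (fun j => fun r => ⌊(Q⁻¹ *ᵥ Z.refFacet (Z.facetClass σ i) (l.succAbove j)) r⌋) := by
    rw [← hstar, Finset.mul_sum, ← Finset.sum_add_distrib]
    refine Finset.sum_congr rfl fun σ _ => ?_
    rw [Finset.mul_sum, ← Finset.sum_add_distrib]
    refine Finset.sum_congr rfl fun i _ => ?_
    rw [det3_sub_eq_sum_sign_potential3 (fun (k : Fin 4) (b : Fin 4) => ⌊(Q⁻¹ *ᵥ Z.refFacet (Z.facetClass σ i) k) (I b)⌋)]
    simp only [Finset.mul_sum]
    rw [← Finset.sum_add_distrib]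
    refine Finset.sum_congr rfl fun l _ => ?_
    have hl := hE (fun j => fun r => ⌊(Q⁻¹ *ᵥ Z.refFacet (Z.facetClass σ i) (l.succAbove j)) r⌋)
    beta_reduce at hl ⊢
    rw [hl]
    ring
  rw [hX, zero_add]
  ring

/-- **`12 ∣ intCoord Z (I,S')`** for every effective tropical `4`-cycle on `ℝᵍ/Qℤᵍ` (`det Q ≠ 0`): the first two Stokes
descents. [cite: MikhalkinZharkov2014Eigenwave, Prop. 4.3] -/
theorem twelve_dvd_intCoord (hQ : IsUnit Q.det) (Z : TropicalTorusCycle g 4 Q) (I S' : Fin 4 → Fin g) :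
    (12 : ℤ) ∣ intCoord Z I S' := by
  obtain ⟨L, -, -, -, h⟩ := exists_weight_intCoord_eq_twelve_mul g I
  exact ⟨_, h Q hQ Z S'⟩

end Twelve


end Summit.HodgeConjecture.HodgeConjecture.Theorems.TropicalWeilVanishing.Ladder

end
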